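/-
b2b-lace packet, LITERATURE seat gen 18 (unit `b2b-lace-lit-g18`).  (S2b)-IMPR, support for the H₁ leaf (L3):
the MASSIVE simple-random-walk integrals `I^μ_{n,l}(x) = ∫ D̂^l Ĉ_μ^n D̂^{(x)} dk/(2π)^d` (`Ĉ_μ = [1 − μ D̂]⁻¹`,
`0 ≤ μ < 1`), their resolvent recursion and geometric tail series, the comparison `0 ≤ I^μ ≤ I`, the
`D̂^{sin}`-shift identity for the symmetrised exponential, the dictionary `Ĉ* = a·Ĉ_μ` for the Step-1 object
`Ĉ*` of [NoBLE17] (3.40), and the EXACT expansion of `∫ D̂^l Ĉ*^q M̂* D̂^{(x)}` in massive tables — with the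
two one-sided bounds of the `m = −1` slot ((S1c)/(S1d) of the packet's L3 spec) as consequences.
d-generic; no numeral, no dimension sentence, no named fact; every existing module untouched.  Farm elaboration of the
whole file ≈ 6 s; no declaration carries a `maxHeartbeats` option (none measured near the default).
-/
import Literature.Probability.FitznerVanDerHofstad2017.NobleLaplacianSplit
import Literature.Probability.FitznerVanDerHofstad2017.SrwIntegralJFarField
import HarnessLib

/-!
# Massive SRW integrals and the exact x-space expansion of [NoBLE17] §3.3.5 Step 1

CITATION HEADER (PLACEMENT v2). Part of a certified REPRODUCTION of R. Fitzner, R. van der Hofstad,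
*Generalized approach to the non-backtracking lace expansion*, Probab. Theory Related Fields 169 (2017)
1041–1119 [NoBLE17] (arXiv:1506.07969), §3.3.4 (3.40)–(3.45) and §3.3.5 Step 1 (3.58)–(3.63) (PTRF
pp. 1072–1076), together with its 2013 predecessor R. Fitzner, *Non-backtracking lace expansion* (PhD thesis,
TU Eindhoven 2013) [Fit13] §3.6.4 (3.6.53)–(3.6.56) p. 107, as consumed by [FvdH17] (EJP 22 (2017) no. 43)
Prop. 2.2 / §3.3 (the `f₃` bound).

> [NoBLE17] (3.40) p. 1072: "`Ĉ*(k) = 1/(1 − F̂_z(0) + α_{F,z}[1 − D̂(k)])`. As `F̂_z(0) ≤ 1` and `α_{F,z} > α̲_F`,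
> we know that `Ĉ*(k) < α_{F,z}⁻¹ Ĉ(k)` … (3.41) `Ĉ*(k) = (1 − F̂_z(0) + α_{F,z})⁻¹ Ĉ_{λ(z)}(k)` with
> `λ(z) = (1/2d) α_{F,z}/(1 − F̂_z(0) + α_{F,z})`, and the monotonicity of `C_λ(x)` in `λ` …
> (3.42) `C*(x) ≤ (1 − F̂_z(0) + α_{F,z})⁻¹ C(x) ≤ α_{F,z}⁻¹ C(x)`."; (3.45): "`M̂*(k) = D̂(k) − 2 D̂^{sin}(k) Ĉ*(k)`".
> [Fit13] (3.6.54)–(3.6.55) p. 107: "We begin by computing a bound on `∫ D̂(k)^l Ĉ*(k)^m M̂*(k) e^{ik·x} d^dk/(2π)^d`.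
> As in (3.6.14) we rewrite `D̂^{sin}(k)` and proceed as in (3.6.16): (3.6.54)
> `= I*_{m,l+1}(x) − (1/d) I*_{m+1,l}(x) + (1/2d²) Σ_ι I*_{m+1,l}(x + 2e_ι)`", `I*_{n,l} = D^{⋆l} ⋆ (C*)^{⋆n}`.

## What is here (namespace `Literature.Probability.FitznerVanDerHofstad2017`; `[cite:]` tags are LOCATORS)

* `srwIm d μ n l x` — the massive analogue of the tree's `srwI` (`Chat d μ` for `Chat d 1`); `srwIm d 1 = srwI d`.
* For `0 ≤ μ < 1` (NO dimension condition — `Ĉ_μ ≤ (1 − μ)⁻¹` is bounded): integrability, the bound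
  `|I^μ_{n,l}(x)| ≤ (1 − μ)^{-n} · mass`, the RESOLVENT RECURSION `μ I^μ_{n+1,l+1} = I^μ_{n+1,l} − I^μ_{n,l}`
  (pointwise `(1 − μD̂) Ĉ_μ = 1`, everywhere), its telescoped form, and the GEOMETRIC TAIL SERIES
  `I^μ_{n+1,l}(x) = Σ_j μ^j I^μ_{n,l+j}(x)` (`hasSum_pow_mul_srwIm`).
* `srwIm_nonneg`, `srwIm_le_srwI`: `0 ≤ I^μ_{n,l}(x) ≤ I_{n,l}(x)` for `0 ≤ μ < 1`, the upper bound for `2n+1 ≤ d`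
  (induction on `n` through the two tail series; the `μ = 1` tail series is the tree's `tendsto_sum_range_srwI`).
* `two_mul_Dsin_mul_DhatSym`: the pointwise kernel identity
  `2 D̂^{sin}(k) D̂^{(x)}(k) = D̂^{(x)}(k)/d − Σ_ι (D̂^{(x+2e_ι)}(k) + D̂^{(x−2e_ι)}(k))/(2d²)`
  (the `D̂^{sin}`-kernel `1/(2d)` at `0`, `−1/(4d²)` at `±2e_ι`, transported through the signed-permutation average).
* `lapAtomsAt_Cstar_eq`: `(lapAtomsAt …).Cstar(k) = a · Ĉ_μ(k)` with `c₀ := 1 − (c_F + α_F + R̂_F(0))`,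
  `a = (c₀ + α_F)⁻¹`, `μ = α_F a` ((3.41)); on the window `c₀ > 0`, `α_F ≥ 0`: `0 < a`, `0 ≤ μ < 1` (`stepOne_params`),
  and `a ≤ α_F⁻¹` (`stepOneA_le_inv`).
* `integral_Cstar_pow_Mstar_eq`: for `0 < c₀`, `0 ≤ α_F`, every `q`:
  `∫ Ĉ*^q M̂* D̂^l D̂^{(x)} dP/(2π)^d = a^q I^μ_{q,l+1}(x) − (a^{q+1}/d) I^μ_{q+1,l}(x) + (a^{q+1}/2d²) Σ_{±ι} I^μ_{q+1,l}(x ± 2e_ι)`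
  — [Fit13] (3.6.55)'s first line with the massive tables in place of `I*` (an IDENTITY; the thesis's next step
  "`≤ IM_{m−2,l}`" is NOT used).
* `integral_Cstar_Mstar_le`, `neg_le_integral_Cstar_Mstar`: the `m = −1` slot (print (3.63)), as in the packet's
  L3 spec (S1c)/(S1d) under the strict window hypothesis `c_F + α_F + R̂_F(0) < 1`:
  `−I_{2,l}(x)/(d α_F²) ≤ ∫ Ĉ* M̂* D̂^l D̂^{(x)} dP/(2π)^d ≤ I_{1,l+1}(x)/α_F + Σ_{±ι} I_{2,l}(x±2e_ι)/(2d² α_F²)`;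
  and the crude companions for `q = m + 2` (`integral_Cstar_pow_Mstar_le_crude`, `neg_le_integral_Cstar_pow_Mstar_crude`).
  The sharp (S1a)/(S1b) (with `𝓙 = srwJ`) need the massive weighted line and are NOT in this module.

READING NOTE (packet DIVERGENCE.md D80; nothing here decides it): the printed (3.61)–(3.62) evaluate the same integral
through an identity valid only at `α_F = 1`; this module types the Laplacian-free expansion of the 2013 generation instead,
whose every term is a massive table dominated by the critical one.
[cite: FitznerVanDerHofstad2016NoBLE, §3.3.4 (3.40)–(3.45) p. 1072, §3.3.5 (3.58)–(3.63) pp. 1074–1076;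
 HaraSlade1992b, App. B (SRW integral bounds)]
-/

noncomputable section

open MeasureTheory Real Finset Filter Topology
open scoped BigOperators

namespace Literature.Probability.FitznerVanDerHofstad2017

open Literature.Barriers.CriticalPhenomena
open Literature.Barriers.CriticalPhenomena.Slade2006Prop53 (P)
open Literature.Probability.LatticeModels

variable {d : ℕ}

/-! ### The massive SRW integrals -/

/-- `I^μ_{n,l}(x) = ∫_{[-π,π]^d} D̂(k)^l Ĉ_μ(k)ⁿ D̂^{(x)}(k) dk/(2π)^d` with `Ĉ_μ = [1 − μ D̂]⁻¹ = Chat d μ`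
(the massive analogue of `srwI`; at `μ = 1` it IS `srwI`).
[cite: FitznerVanDerHofstad2016NoBLE, (3.35) and (3.41) pp. 1071–1072] -/
def srwIm (d : ℕ) (μ : ℝ) (n l : ℕ) (x : Fin d → ℤ) : ℝ :=
  (∫ k, (Dhat d k ^ l * DhatSym d x k) * Chat d μ k ^ n ∂P d) / (2 * π) ^ d

/-- `I^1_{n,l} = I_{n,l}`. [folklore] -/
theorem srwIm_one (n l : ℕ) (x : Fin d → ℤ) : srwIm d 1 n l x = srwI d n l x := rfl

/-- `I^μ_{0,l} = I_{0,l}` (no Green's function factor). [folklore] -/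
theorem srwIm_zero_left (μ : ℝ) (l : ℕ) (x : Fin d → ℤ) : srwIm d μ 0 l x = srwI d 0 l x := by
  simp [srwIm, srwI]

/-- For `0 ≤ μ < 1` the massive Green's function is continuous in `k` (denominator `≥ 1 − μ > 0`). [folklore] -/
theorem continuous_Chat_of_lt_one {μ : ℝ} (hμ0 : 0 ≤ μ) (hμ1 : μ < 1) : Continuous (Chat d μ) := by
  have h : Chat d μ = fun k => (1 - μ * Dhat d k)⁻¹ := by
    funext k; rw [Chat_def, one_div]
  rw [h]
  refine Continuous.inv₀ (continuous_const.sub (continuous_const.mul (continuous_Dhat d))) fun k => ?_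
  exact (one_sub_mul_Dhat_pos hμ0 hμ1 k).ne'

/-- `0 ≤ Ĉ_μ ≤ (1 − μ)⁻¹` for `0 ≤ μ < 1`, hence `|Ĉ_μⁿ| ≤ (1 − μ)^{-n}`. [folklore] -/
theorem abs_Chat_pow_le {μ : ℝ} (hμ0 : 0 ≤ μ) (hμ1 : μ < 1) (n : ℕ) (k : Fin d → ℝ) :
    |Chat d μ k ^ n| ≤ (1 / (1 - μ)) ^ n := by
  rw [abs_pow, abs_of_pos (Chat_pos hμ0 hμ1 k)]
  exact pow_le_pow_left₀ (Chat_pos hμ0 hμ1 k).le (Chat_le_one_div hμ0 hμ1 k) n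

/-- Pointwise bound of the massive integrand: `|D̂^l D̂^{(x)} Ĉ_μⁿ| ≤ (1 − μ)^{-n}` (`0 ≤ μ < 1`). [folklore] -/
theorem abs_srwIm_integrand_le {μ : ℝ} (hμ0 : 0 ≤ μ) (hμ1 : μ < 1) (n l : ℕ) (x : Fin d → ℤ)
    (k : Fin d → ℝ) : |(Dhat d k ^ l * DhatSym d x k) * Chat d μ k ^ n| ≤ (1 / (1 - μ)) ^ n := by
  have h1 : |Dhat d k ^ l| ≤ 1 := by rw [abs_pow]; exact pow_le_one₀ (abs_nonneg _) (abs_Dhat_le_one k)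
  have h2 : |DhatSym d x k| ≤ 1 := abs_DhatSym_le_one x k
  have h3 : |Chat d μ k ^ n| ≤ (1 / (1 - μ)) ^ n := abs_Chat_pow_le hμ0 hμ1 n k
  rw [abs_mul, abs_mul]
  calc |Dhat d k ^ l| * |DhatSym d x k| * |Chat d μ k ^ n|
      ≤ 1 * 1 * (1 / (1 - μ)) ^ n :=
        mul_le_mul (mul_le_mul h1 h2 (abs_nonneg _) zero_le_one) h3 (abs_nonneg _) (by norm_num)
    _ = (1 / (1 - μ)) ^ n := by ring

/-- The massive integrand is integrable on the cube for `0 ≤ μ < 1` (bounded and measurable; NO condition on `d`).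
[folklore] -/
theorem integrable_srwIm_integrand {μ : ℝ} (hμ0 : 0 ≤ μ) (hμ1 : μ < 1) (n l : ℕ) (x : Fin d → ℤ) :
    Integrable (fun k => (Dhat d k ^ l * DhatSym d x k) * Chat d μ k ^ n) (P d) := by
  have hmeas : AEStronglyMeasurable (fun k => (Dhat d k ^ l * DhatSym d x k) * Chat d μ k ^ n) (P d) :=
    ((((continuous_Dhat d).pow l).mul (continuous_DhatSym d x)).mul
      ((continuous_Chat_of_lt_one hμ0 hμ1).pow n)).aestronglyMeasurable
  refine (integrable_const ((1 / (1 - μ)) ^ n)).mono' hmeas (ae_of_all _ fun k => ?_)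
  rw [Real.norm_eq_abs]
  exact abs_srwIm_integrand_le hμ0 hμ1 n l x k

/-- A uniform bound: `|I^μ_{n,l}(x)| ≤ (1 − μ)^{-n} · (P(cube)/(2π)^d)` for `0 ≤ μ < 1`. [folklore] -/
theorem abs_srwIm_le {μ : ℝ} (hμ0 : 0 ≤ μ) (hμ1 : μ < 1) (n l : ℕ) (x : Fin d → ℤ) :
    |srwIm d μ n l x| ≤ (1 / (1 - μ)) ^ n * (P d).real Set.univ / (2 * π) ^ d := by
  unfold srwIm
  rw [abs_div, abs_of_pos (two_pi_pow_pos d)]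
  refine div_le_div_of_nonneg_right ?_ (two_pi_pow_pos d).le
  have h := norm_integral_le_of_norm_le_const (μ := P d)
    (f := fun k => (Dhat d k ^ l * DhatSym d x k) * Chat d μ k ^ n) (C := (1 / (1 - μ)) ^ n)
    (ae_of_all _ fun k => by rw [Real.norm_eq_abs]; exact abs_srwIm_integrand_le hμ0 hμ1 n l x k)
  rw [Real.norm_eq_abs] at h
  linarith

/-! ### The resolvent recursion and the geometric tail series -/

/-- Pointwise: `(1 − μ D̂(k)) Ĉ_μ(k) = 1` for `0 ≤ μ < 1` (EVERYWHERE, no null set). [folklore] -/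
theorem one_sub_mul_Dhat_mul_Chat {μ : ℝ} (hμ0 : 0 ≤ μ) (hμ1 : μ < 1) (k : Fin d → ℝ) :
    (1 - μ * Dhat d k) * Chat d μ k = 1 := by
  rw [Chat_def]
  field_simp [(one_sub_mul_Dhat_pos hμ0 hμ1 k).ne']

/-- **Resolvent recursion**: `μ I^μ_{n+1,l+1}(x) = I^μ_{n+1,l}(x) − I^μ_{n,l}(x)` (`0 ≤ μ < 1`; no condition on `d`).
The massive form of [NoBLE17] (5.1). [cite: FitznerVanDerHofstad2016NoBLE, (5.1) p. 1090] -/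
theorem mul_srwIm_succ_succ {μ : ℝ} (hμ0 : 0 ≤ μ) (hμ1 : μ < 1) (n l : ℕ) (x : Fin d → ℤ) :
    μ * srwIm d μ (n + 1) (l + 1) x = srwIm d μ (n + 1) l x - srwIm d μ n l x := by
  have hA := integrable_srwIm_integrand hμ0 hμ1 (n + 1) l x
  have hB := integrable_srwIm_integrand hμ0 hμ1 n l x
  have key : ∫ k, μ * ((Dhat d k ^ (l + 1) * DhatSym d x k) * Chat d μ k ^ (n + 1)) ∂P d =
      ∫ k, ((Dhat d k ^ l * DhatSym d x k) * Chat d μ k ^ (n + 1)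
        - (Dhat d k ^ l * DhatSym d x k) * Chat d μ k ^ n) ∂P d := by
    refine integral_congr_ae (ae_of_all _ fun k => ?_)
    have hk := one_sub_mul_Dhat_mul_Chat hμ0 hμ1 k
    simp only
    linear_combination (-(Dhat d k ^ l * DhatSym d x k * Chat d μ k ^ n)) * hk
  rw [integral_const_mul, integral_sub hA hB] at key
  unfold srwIm
  rw [← sub_div, ← key]
  ring

/-- Telescoped recursion: `I^μ_{n+1,l}(x) = Σ_{j<N} μ^j I^μ_{n,l+j}(x) + μ^N I^μ_{n+1,l+N}(x)`. [folklore] -/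
theorem srwIm_succ_telescope {μ : ℝ} (hμ0 : 0 ≤ μ) (hμ1 : μ < 1) (n l : ℕ) (x : Fin d → ℤ) (N : ℕ) :
    srwIm d μ (n + 1) l x =
      (∑ j ∈ Finset.range N, μ ^ j * srwIm d μ n (l + j) x) + μ ^ N * srwIm d μ (n + 1) (l + N) x := by
  induction N with
  | zero => simp
  | succ N ih =>
    rw [Finset.sum_range_succ, ← add_assoc l N 1, pow_succ]
    have h := mul_srwIm_succ_succ hμ0 hμ1 n (l + N) x
    have : μ ^ N * srwIm d μ (n + 1) (l + N) x =
        μ ^ N * srwIm d μ n (l + N) x + μ ^ N * μ * srwIm d μ (n + 1) (l + N + 1) x := by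
      rw [mul_assoc, h]; ring
    rw [ih, this]; ring

/-- **Geometric tail series**: `I^μ_{n+1,l}(x) = Σ_{j ≥ 0} μ^j I^μ_{n,l+j}(x)` for `0 ≤ μ < 1` (no condition on `d`).
[cite: FitznerVanDerHofstad2016NoBLE, (3.41)–(3.42) p. 1072 (massive walk), (5.1) p. 1090] -/
theorem hasSum_pow_mul_srwIm {μ : ℝ} (hμ0 : 0 ≤ μ) (hμ1 : μ < 1) (n l : ℕ) (x : Fin d → ℤ) :
    HasSum (fun j => μ ^ j * srwIm d μ n (l + j) x) (srwIm d μ (n + 1) l x) := by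
  set B : ℝ := (1 / (1 - μ)) ^ (n + 1) * (P d).real Set.univ / (2 * π) ^ d with hB
  have hBn : ∀ j, |srwIm d μ (n + 1) (l + j) x| ≤ B := fun j => abs_srwIm_le hμ0 hμ1 (n + 1) (l + j) x
  have hB0 : 0 ≤ B := le_trans (abs_nonneg _) (hBn 0)
  -- summability of the norms: `|μ^j I^μ_{n,l+j}| ≤ μ^j B'`
  set B' : ℝ := (1 / (1 - μ)) ^ n * (P d).real Set.univ / (2 * π) ^ d with hB'
  have hB'n : ∀ j, |srwIm d μ n (l + j) x| ≤ B' := fun j => abs_srwIm_le hμ0 hμ1 n (l + j) x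
  have hsum : Summable fun j => ‖μ ^ j * srwIm d μ n (l + j) x‖ := by
    refine Summable.of_nonneg_of_le (fun j => norm_nonneg _) (fun j => ?_)
      ((summable_geometric_of_lt_one hμ0 hμ1).mul_right B')
    rw [Real.norm_eq_abs, abs_mul, abs_pow, abs_of_nonneg hμ0]
    exact mul_le_mul_of_nonneg_left (hB'n j) (pow_nonneg hμ0 j)
  rw [hasSum_iff_tendsto_nat_of_summable_norm hsum]
  have hrem : Tendsto (fun N => μ ^ N * srwIm d μ (n + 1) (l + N) x) atTop (𝓝 0) := by
    have hg := tendsto_pow_atTop_nhds_zero_of_lt_one hμ0 hμ1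
    rw [Metric.tendsto_atTop] at hg ⊢
    intro ε hε
    obtain ⟨N₀, hN₀⟩ := hg (ε / (B + 1)) (by positivity)
    refine ⟨N₀, fun N hN => ?_⟩
    have h1 := hN₀ N hN
    rw [Real.dist_eq, sub_zero, abs_of_nonneg (pow_nonneg hμ0 N)] at h1
    rw [Real.dist_eq, sub_zero, abs_mul, abs_of_nonneg (pow_nonneg hμ0 N)]
    calc μ ^ N * |srwIm d μ (n + 1) (l + N) x| ≤ μ ^ N * B := by gcongr; exact hBn N
      _ ≤ ε / (B + 1) * B := by gcongr
      _ < ε := by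
        rw [div_mul_eq_mul_div, div_lt_iff₀ (by linarith)]
        nlinarith
  have heq : ∀ N, ∑ j ∈ Finset.range N, μ ^ j * srwIm d μ n (l + j) x =
      srwIm d μ (n + 1) l x - μ ^ N * srwIm d μ (n + 1) (l + N) x := fun N => by
    rw [srwIm_succ_telescope hμ0 hμ1 n l x N]; ring
  simp_rw [heq]
  simpa using tendsto_const_nhds.sub hrem

/-! ### `0 ≤ I^μ ≤ I` -/

/-- `0 ≤ I^μ_{n,l}(x)` and, for `2n+1 ≤ d`, `I^μ_{n,l}(x) ≤ I_{n,l}(x)` (`0 ≤ μ < 1`): induction on `n` through the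
two tail series (massive: geometric; critical: the tree's `tendsto_sum_range_srwI`), starting from
`I^μ_{0,l} = I_{0,l} = p_l ≥ 0`. [cite: FitznerVanDerHofstad2016NoBLE, (3.42) p. 1072 ("monotonicity of C_λ(x) in λ")] -/
theorem srwIm_nonneg_and_le {μ : ℝ} (hμ0 : 0 ≤ μ) (hμ1 : μ < 1) :
    ∀ (n : ℕ) (l : ℕ) (x : Fin d → ℤ),
      0 ≤ srwIm d μ n l x ∧ (2 * n + 1 ≤ d → srwIm d μ n l x ≤ srwI d n l x) := by
  intro n
  induction n with
  | zero =>
    intro l x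
    refine ⟨?_, fun _ => (srwIm_zero_left μ l x).le⟩
    rw [srwIm_zero_left, srwI_zero_eq_srwLaw]
    exact LongRangePhi4.srwLaw_nonneg l x
  | succ n ih =>
    intro l x
    have hser := hasSum_pow_mul_srwIm hμ0 hμ1 n l x
    have hterm : ∀ j, 0 ≤ μ ^ j * srwIm d μ n (l + j) x :=
      fun j => mul_nonneg (pow_nonneg hμ0 j) (ih (l + j) x).1
    refine ⟨hser.nonneg hterm, fun hd => ?_⟩
    have hd' : 2 * n + 1 ≤ d := by omega
    -- compare partial sums with the critical tail series
    have hcrit := tendsto_sum_range_srwI (d := d) (n := n) hd l x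
    have hmass := hser.tendsto_sum_nat
    refine le_of_tendsto_of_tendsto' hmass hcrit fun N => Finset.sum_le_sum fun j _ => ?_
    have h1 : srwIm d μ n (l + j) x ≤ srwI d n (l + j) x := (ih (l + j) x).2 hd'
    have h0 : 0 ≤ srwIm d μ n (l + j) x := (ih (l + j) x).1
    calc μ ^ j * srwIm d μ n (l + j) x ≤ 1 * srwIm d μ n (l + j) x :=
          mul_le_mul_of_nonneg_right (pow_le_one₀ hμ0 hμ1.le) h0
      _ ≤ srwI d n (l + j) x := by rw [one_mul]; exact h1

/-- `0 ≤ I^μ_{n,l}(x)` for `0 ≤ μ < 1`. [cite: FitznerVanDerHofstad2016NoBLE, (3.41) p. 1072] -/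
theorem srwIm_nonneg {μ : ℝ} (hμ0 : 0 ≤ μ) (hμ1 : μ < 1) (n l : ℕ) (x : Fin d → ℤ) : 0 ≤ srwIm d μ n l x :=
  (srwIm_nonneg_and_le hμ0 hμ1 n l x).1

/-- `I^μ_{n,l}(x) ≤ I_{n,l}(x)` for `0 ≤ μ < 1` and `2n+1 ≤ d` — the table form of `C_μ ≤ C` ((3.42)).
[cite: FitznerVanDerHofstad2016NoBLE, (3.42) p. 1072] -/
theorem srwIm_le_srwI {n : ℕ} (hd : 2 * n + 1 ≤ d) {μ : ℝ} (hμ0 : 0 ≤ μ) (hμ1 : μ < 1) (l : ℕ)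
    (x : Fin d → ℤ) : srwIm d μ n l x ≤ srwI d n l x :=
  (srwIm_nonneg_and_le hμ0 hμ1 n l x).2 hd


/-! ### The `D̂^{sin}`-shift identity for the symmetrised exponential -/

/-- The phase of `D̂^{(x + a e_ι)}`: `Σ_j δ_j (x + a e_ι)_{ν j} k_j = Σ_j δ_j x_{ν j} k_j + δ_{ν⁻¹ι} a k_{ν⁻¹ι}`. [folklore] -/
theorem phase_add_axisVec (ν : Equiv.Perm (Fin d)) (δ : Fin d → ℤˣ) (x : Fin d → ℤ) (ι : Fin d) (a : ℤ)
    (k : Fin d → ℝ) :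
    ∑ j, (((δ j : ℤ) : ℝ) * ((x + axisVec ι a) (ν j) : ℝ)) * k j
      = (∑ j, (((δ j : ℤ) : ℝ) * (x (ν j) : ℝ)) * k j) + ((δ (ν.symm ι) : ℤ) : ℝ) * a * k (ν.symm ι) := by
  classical
  have hsplit : ∀ j, (((δ j : ℤ) : ℝ) * ((x + axisVec ι a) (ν j) : ℝ)) * k j =
      (((δ j : ℤ) : ℝ) * (x (ν j) : ℝ)) * k j
        + (if j = ν.symm ι then ((δ j : ℤ) : ℝ) * a * k j else 0) := by
    intro j
    simp only [Pi.add_apply, axisVec, Int.cast_add]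
    by_cases hj : j = ν.symm ι
    · subst hj
      simp [Equiv.apply_symm_apply]; ring
    · have hne : ν j ≠ ι := fun h => hj (by rw [← h, Equiv.symm_apply_apply])
      simp [hne, hj]
  simp_rw [hsplit]
  rw [Finset.sum_add_distrib, Finset.sum_ite_eq' Finset.univ (ν.symm ι)]
  simp

/-- `cos(φ + δ t) + cos(φ − δ t) = 2 cos φ cos t` for a sign `δ = ±1`. [folklore] -/
theorem cos_add_sign_mul_add_cos_sub (φ t : ℝ) (δ : ℤˣ) :
    Real.cos (φ + ((δ : ℤ) : ℝ) * t) + Real.cos (φ + ((δ : ℤ) : ℝ) * (-t)) = 2 * Real.cos φ * Real.cos t := by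
  rcases Int.units_eq_one_or δ with h | h <;> simp [h, Real.cos_add, Real.cos_neg, Real.sin_neg]
    <;> ring

/-- **Shift identity**: `Σ_ι (D̂^{(x+2e_ι)}(k) + D̂^{(x−2e_ι)}(k)) = 2 (Σ_j cos(2k_j)) D̂^{(x)}(k)` — the doubled-step
symbol `D̂(2k)` acts on the symmetrised exponential exactly as on `cos(k·x)`. [folklore] -/
theorem sum_DhatSym_shift_two (x : Fin d → ℤ) (k : Fin d → ℝ) :
    ∑ ι, (DhatSym d (x + axisVec ι 2) k + DhatSym d (x - axisVec ι 2) k)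
      = 2 * (∑ j, Real.cos (2 * k j)) * DhatSym d x k := by
  classical
  -- each signed permutation separately
  have hι : ∀ (ν : Equiv.Perm (Fin d)) (δ : Fin d → ℤˣ) (ι : Fin d),
      Real.cos (∑ j, (((δ j : ℤ) : ℝ) * ((x + axisVec ι 2) (ν j) : ℝ)) * k j)
          + Real.cos (∑ j, (((δ j : ℤ) : ℝ) * ((x - axisVec ι 2) (ν j) : ℝ)) * k j)
        = 2 * Real.cos (∑ j, (((δ j : ℤ) : ℝ) * (x (ν j) : ℝ)) * k j) * Real.cos (2 * k (ν.symm ι)) := by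
    intro ν δ ι
    rw [sub_axisVec_eq_add, phase_add_axisVec, phase_add_axisVec]
    push_cast
    have := cos_add_sign_mul_add_cos_sub (∑ j, (((δ j : ℤ) : ℝ) * (x (ν j) : ℝ)) * k j)
      (2 * k (ν.symm ι)) (δ (ν.symm ι))
    rw [show ((δ (ν.symm ι) : ℤ) : ℝ) * (2 : ℝ) * k (ν.symm ι) = ((δ (ν.symm ι) : ℤ) : ℝ) * (2 * k (ν.symm ι)) by ring,
      show ((δ (ν.symm ι) : ℤ) : ℝ) * (-2 : ℝ) * k (ν.symm ι) = ((δ (ν.symm ι) : ℤ) : ℝ) * (-(2 * k (ν.symm ι))) by ring]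
    exact this
  have hinner : ∀ (ν : Equiv.Perm (Fin d)) (δ : Fin d → ℤˣ),
      ∑ ι : Fin d, (Real.cos (∑ j, (((δ j : ℤ) : ℝ) * ((x + axisVec ι 2) (ν j) : ℝ)) * k j)
          + Real.cos (∑ j, (((δ j : ℤ) : ℝ) * ((x - axisVec ι 2) (ν j) : ℝ)) * k j))
        = 2 * (∑ j, Real.cos (2 * k j)) * Real.cos (∑ j, (((δ j : ℤ) : ℝ) * (x (ν j) : ℝ)) * k j) := by
    intro ν δ
    simp_rw [hι ν δ]
    rw [← Finset.mul_sum]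
    have hre : ∑ ι, Real.cos (2 * k (ν.symm ι)) = ∑ j, Real.cos (2 * k j) :=
      Equiv.sum_comp ν.symm (fun j => Real.cos (2 * k j))
    rw [hre]; ring
  have key : ∑ ι : Fin d, ((∑ ν : Equiv.Perm (Fin d), ∑ δ : Fin d → ℤˣ,
          Real.cos (∑ j, (((δ j : ℤ) : ℝ) * ((x + axisVec ι 2) (ν j) : ℝ)) * k j))
        + (∑ ν : Equiv.Perm (Fin d), ∑ δ : Fin d → ℤˣ,
          Real.cos (∑ j, (((δ j : ℤ) : ℝ) * ((x - axisVec ι 2) (ν j) : ℝ)) * k j)))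
      = 2 * (∑ j, Real.cos (2 * k j)) * ∑ ν : Equiv.Perm (Fin d), ∑ δ : Fin d → ℤˣ,
          Real.cos (∑ j, (((δ j : ℤ) : ℝ) * (x (ν j) : ℝ)) * k j) := by
    calc ∑ ι : Fin d, ((∑ ν : Equiv.Perm (Fin d), ∑ δ : Fin d → ℤˣ,
              Real.cos (∑ j, (((δ j : ℤ) : ℝ) * ((x + axisVec ι 2) (ν j) : ℝ)) * k j))
            + (∑ ν : Equiv.Perm (Fin d), ∑ δ : Fin d → ℤˣ,
              Real.cos (∑ j, (((δ j : ℤ) : ℝ) * ((x - axisVec ι 2) (ν j) : ℝ)) * k j)))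
        = ∑ ι : Fin d, ∑ ν : Equiv.Perm (Fin d), ∑ δ : Fin d → ℤˣ,
            (Real.cos (∑ j, (((δ j : ℤ) : ℝ) * ((x + axisVec ι 2) (ν j) : ℝ)) * k j)
              + Real.cos (∑ j, (((δ j : ℤ) : ℝ) * ((x - axisVec ι 2) (ν j) : ℝ)) * k j)) := by
          refine Finset.sum_congr rfl fun ι _ => ?_
          rw [← Finset.sum_add_distrib]
          refine Finset.sum_congr rfl fun ν _ => ?_
          rw [← Finset.sum_add_distrib]
      _ = ∑ ν : Equiv.Perm (Fin d), ∑ δ : Fin d → ℤˣ, ∑ ι : Fin d,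
            (Real.cos (∑ j, (((δ j : ℤ) : ℝ) * ((x + axisVec ι 2) (ν j) : ℝ)) * k j)
              + Real.cos (∑ j, (((δ j : ℤ) : ℝ) * ((x - axisVec ι 2) (ν j) : ℝ)) * k j)) := by
          rw [Finset.sum_comm]
          refine Finset.sum_congr rfl fun ν _ => ?_
          rw [Finset.sum_comm]
      _ = ∑ ν : Equiv.Perm (Fin d), ∑ δ : Fin d → ℤˣ,
            2 * (∑ j, Real.cos (2 * k j)) * Real.cos (∑ j, (((δ j : ℤ) : ℝ) * (x (ν j) : ℝ)) * k j) := by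
          refine Finset.sum_congr rfl fun ν _ => Finset.sum_congr rfl fun δ _ => ?_
          exact hinner ν δ
      _ = 2 * (∑ j, Real.cos (2 * k j)) * ∑ ν : Equiv.Perm (Fin d), ∑ δ : Fin d → ℤˣ,
            Real.cos (∑ j, (((δ j : ℤ) : ℝ) * (x (ν j) : ℝ)) * k j) := by
          simp_rw [Finset.mul_sum]
  simp only [DhatSym_def]
  simp_rw [← add_div]
  rw [← Finset.sum_div, key, mul_div_assoc]

/-- `Σ_j sin²(k_j) = d/2 − (Σ_j cos(2k_j))/2`. [folklore] -/
theorem sum_sin_sq_eq (k : Fin d → ℝ) : ∑ j, Real.sin (k j) ^ 2 = d / 2 - (∑ j, Real.cos (2 * k j)) / 2 := by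
  have h : ∀ j, Real.sin (k j) ^ 2 = 1 / 2 - Real.cos (2 * k j) / 2 := fun j => by
    rw [Real.sin_sq, Real.cos_sq]; ring
  simp_rw [h]
  rw [Finset.sum_sub_distrib, Finset.sum_const, Finset.card_univ, Fintype.card_fin, ← Finset.sum_div]
  simp [nsmul_eq_mul]
  ring

/-- **The `D̂^{sin}`-kernel on the symmetrised exponential** (`d ≥ 1`):
`2 D̂^{sin}(k) D̂^{(x)}(k) = D̂^{(x)}(k)/d − Σ_ι (D̂^{(x+2e_ι)}(k) + D̂^{(x−2e_ι)}(k))/(2d²)`, i.e. `D^{sin}` is the kernel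
`1/(2d)` at `0`, `−1/(4d²)` at `±2e_ι` ([NoBLE17] (3.23), (3.27)–(3.28); [Fit13] (3.6.13)).
[cite: FitznerVanDerHofstad2016NoBLE, §3.3.3 (3.23), (3.27)–(3.28) pp. 1069–1070] -/
theorem two_mul_Dsin_mul_DhatSym (hd : 1 ≤ d) (x : Fin d → ℤ) (k : Fin d → ℝ) :
    2 * Dsin d k * DhatSym d x k
      = DhatSym d x k / d - (∑ ι, (DhatSym d (x + axisVec ι 2) k + DhatSym d (x - axisVec ι 2) k)) / (2 * (d : ℝ) ^ 2) := by
  have hd0 : (d : ℝ) ≠ 0 := by exact_mod_cast (show d ≠ 0 by omega)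
  rw [sum_DhatSym_shift_two, Dsin, sum_sin_sq_eq]
  field_simp

/-! ### The dictionary `Ĉ* = a · Ĉ_μ` and the exact expansion of Step 1 -/

section StepOne

variable {cΦ αΦ cF αF : ℝ} {RΦ RF : Site d → ℝ}

/-- The scale `a = (c₀ + α_F)⁻¹ = (1 − c_F − R̂_F(0))⁻¹` of (3.41) (`c₀ = 1 − F̂_z(0)`).
[cite: FitznerVanDerHofstad2016NoBLE, (3.41) p. 1072] -/
def stepOneA (cF αF : ℝ) (RF : Site d → ℝ) : ℝ := 1 / (1 - (cF + αF + cosFT RF 0) + αF)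

/-- The mass parameter `μ = α_F a = 2d·λ(z)` of (3.41). [cite: FitznerVanDerHofstad2016NoBLE, (3.41) p. 1072] -/
def stepOneMu (cF αF : ℝ) (RF : Site d → ℝ) : ℝ := αF * stepOneA cF αF RF

/-- The denominator of `Ĉ*` read at `lapAtomsAt`: `c₀ + α_F (1 − D̂(k))`. [cite: FitznerVanDerHofstad2016NoBLE, (3.40) p. 1072] -/
theorem lapAtomsAt_Cden_eq (k : Fin d → ℝ) :
    (lapAtomsAt d cΦ αΦ cF αF RΦ RF k).Cden = (1 - (cF + αF + cosFT RF 0)) + αF * (1 - Dhat d k) := by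
  simp only [LapAtoms.Cden, lapAtomsAt_Q, lapAtomsAt_δRF]
  ring

/-- **(3.41) as an identity**: `Ĉ*(k) = a · Ĉ_μ(k)` with `a = stepOneA`, `μ = stepOneMu`, whenever `c₀ + α_F ≠ 0`.
[cite: FitznerVanDerHofstad2016NoBLE, (3.41) p. 1072] -/
theorem lapAtomsAt_Cstar_eq (h : 1 - (cF + αF + cosFT RF 0) + αF ≠ 0) (k : Fin d → ℝ) :
    (lapAtomsAt d cΦ αΦ cF αF RΦ RF k).Cstar = stepOneA cF αF RF * Chat d (stepOneMu cF αF RF) k := by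
  rw [LapAtoms.Cstar, lapAtomsAt_Cden_eq, stepOneMu, stepOneA, Chat_def]
  have h2 : 1 - αF * (1 / (1 - (cF + αF + cosFT RF 0) + αF)) * Dhat d k
      = ((1 - (cF + αF + cosFT RF 0)) + αF * (1 - Dhat d k)) / (1 - (cF + αF + cosFT RF 0) + αF) := by
    field_simp
    ring
  rw [h2]
  by_cases hD : (1 - (cF + αF + cosFT RF 0)) + αF * (1 - Dhat d k) = 0
  · rw [hD]; simp
  · field_simp

/-- `M̂*` read at `lapAtomsAt`: `D̂(k) − 2 D̂^{sin}(k) Ĉ*(k)`. [cite: FitznerVanDerHofstad2016NoBLE, (3.45) p. 1072] -/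
theorem lapAtomsAt_Mstar_eq (k : Fin d → ℝ) :
    (lapAtomsAt d cΦ αΦ cF αF RΦ RF k).Mstar = Dhat d k - 2 * Dsin d k * (lapAtomsAt d cΦ αΦ cF αF RΦ RF k).Cstar := rfl

/-- On the window (`c₀ = 1 − F̂_z(0) > 0`) with `α_F ≥ 0`: `0 < a`, `0 ≤ μ < 1`. [cite: FitznerVanDerHofstad2016NoBLE, (3.41)–(3.42) p. 1072] -/
theorem stepOne_params (hc0 : cF + αF + cosFT RF 0 < 1) (hα : 0 ≤ αF) :
    0 < stepOneA cF αF RF ∧ 0 ≤ stepOneMu cF αF RF ∧ stepOneMu cF αF RF < 1 := by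
  have hpos : 0 < 1 - (cF + αF + cosFT RF 0) + αF := by linarith
  refine ⟨by unfold stepOneA; positivity, ?_, ?_⟩
  · unfold stepOneMu stepOneA; positivity
  · unfold stepOneMu stepOneA
    rw [mul_one_div, div_lt_one hpos]
    linarith

/-- `a ≤ α_F⁻¹` when `c₀ ≥ 0 < α_F`. [cite: FitznerVanDerHofstad2016NoBLE, (3.42) p. 1072] -/
theorem stepOneA_le_inv (hc0 : cF + αF + cosFT RF 0 ≤ 1) (hα : 0 < αF) : stepOneA cF αF RF ≤ 1 / αF := by
  unfold stepOneA
  exact one_div_le_one_div_of_le hα (by linarith)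

/-- `S_{p,l}(x) := Σ_ι (I_{p,l}(x + 2e_ι) + I_{p,l}(x − 2e_ι))` — the shifted table sum produced by the `D̂^{sin}`-kernel.
[cite: FitznerVanDerHofstad2016NoBLE, (3.30) p. 1070] -/
def srwIShift2 (d p l : ℕ) (x : Fin d → ℤ) : ℝ :=
  ∑ ι : Fin d, (srwI d p l (x + axisVec ι 2) + srwI d p l (x - axisVec ι 2))

/-- `S_{p,l}(x) ≥ 0` for `2p+1 ≤ d`. [folklore] -/
theorem srwIShift2_nonneg {p : ℕ} (hd : 2 * p + 1 ≤ d) (l : ℕ) (x : Fin d → ℤ) : 0 ≤ srwIShift2 d p l x :=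
  Finset.sum_nonneg fun _ _ => add_nonneg (srwI_nonneg p hd _ _) (srwI_nonneg p hd _ _)

/-- **The exact expansion of Step 1** ([Fit13] (3.6.55) made into an identity; [NoBLE17] (3.58) with (3.45), (3.23)):
for every `q ≥ 0`, on the window `c₀ > 0` with `α_F ≥ 0`,
`∫ Ĉ*^q M̂* D̂^l D̂^{(x)} dP/(2π)^d = a^q I^μ_{q,l+1}(x) − (a^{q+1}/d) I^μ_{q+1,l}(x) + (a^{q+1}/2d²) Σ_ι (I^μ_{q+1,l}(x+2e_ι) + I^μ_{q+1,l}(x−2e_ι))`.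
[cite: FitznerVanDerHofstad2016NoBLE, §3.3.5 (3.58), (3.61)–(3.63) pp. 1074–1076] -/
theorem integral_Cstar_pow_Mstar_eq (hd : 1 ≤ d) (hc0 : cF + αF + cosFT RF 0 < 1) (hα : 0 ≤ αF)
    (q l : ℕ) (x : Fin d → ℤ) :
    (∫ k, (lapAtomsAt d cΦ αΦ cF αF RΦ RF k).Cstar ^ q * (lapAtomsAt d cΦ αΦ cF αF RΦ RF k).Mstar *
        (Dhat d k ^ l * DhatSym d x k) ∂P d) / (2 * π) ^ d
      = stepOneA cF αF RF ^ q * srwIm d (stepOneMu cF αF RF) q (l + 1) x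
        - stepOneA cF αF RF ^ (q + 1) / d * srwIm d (stepOneMu cF αF RF) (q + 1) l x
        + stepOneA cF αF RF ^ (q + 1) / (2 * (d : ℝ) ^ 2) *
            ∑ ι, (srwIm d (stepOneMu cF αF RF) (q + 1) l (x + axisVec ι 2)
                  + srwIm d (stepOneMu cF αF RF) (q + 1) l (x - axisVec ι 2)) := by
  obtain ⟨ha, hμ0, hμ1⟩ := stepOne_params (d := d) (RF := RF) hc0 hα
  set a := stepOneA cF αF RF with ha_def
  set μ := stepOneMu cF αF RF with hμ_def
  have hne : 1 - (cF + αF + cosFT RF 0) + αF ≠ 0 := by linarith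
  -- the three integrable pieces
  set f1 : (Fin d → ℝ) → ℝ := fun k => (Dhat d k ^ (l + 1) * DhatSym d x k) * Chat d μ k ^ q with hf1
  set f2 : (Fin d → ℝ) → ℝ := fun k => (Dhat d k ^ l * DhatSym d x k) * Chat d μ k ^ (q + 1) with hf2
  set g : Fin d → (Fin d → ℝ) → ℝ := fun ι k =>
    (Dhat d k ^ l * DhatSym d (x + axisVec ι 2) k) * Chat d μ k ^ (q + 1)
      + (Dhat d k ^ l * DhatSym d (x - axisVec ι 2) k) * Chat d μ k ^ (q + 1) with hg
  have hf1i : Integrable f1 (P d) := integrable_srwIm_integrand hμ0 hμ1 q (l + 1) x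
  have hf2i : Integrable f2 (P d) := integrable_srwIm_integrand hμ0 hμ1 (q + 1) l x
  have hgi : ∀ ι, Integrable (g ι) (P d) := fun ι =>
    (integrable_srwIm_integrand hμ0 hμ1 (q + 1) l (x + axisVec ι 2)).add
      (integrable_srwIm_integrand hμ0 hμ1 (q + 1) l (x - axisVec ι 2))
  -- the pointwise expansion
  have hpt : ∀ k, (lapAtomsAt d cΦ αΦ cF αF RΦ RF k).Cstar ^ q * (lapAtomsAt d cΦ αΦ cF αF RΦ RF k).Mstar *
        (Dhat d k ^ l * DhatSym d x k)
      = a ^ q * f1 k - a ^ (q + 1) / d * f2 k + a ^ (q + 1) / (2 * (d : ℝ) ^ 2) * ∑ ι, g ι k := by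
    intro k
    have hC := lapAtomsAt_Cstar_eq (d := d) (cΦ := cΦ) (αΦ := αΦ) (RΦ := RΦ) hne k
    rw [← ha_def, ← hμ_def] at hC
    have hS := two_mul_Dsin_mul_DhatSym hd x k
    rw [lapAtomsAt_Mstar_eq, hC]
    simp only [hf1, hf2, hg, Finset.sum_add_distrib]
    rw [← Finset.sum_add_distrib]
    have hsum : ∑ ι, ((Dhat d k ^ l * DhatSym d (x + axisVec ι 2) k) * Chat d μ k ^ (q + 1)
          + (Dhat d k ^ l * DhatSym d (x - axisVec ι 2) k) * Chat d μ k ^ (q + 1))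
        = (Dhat d k ^ l * Chat d μ k ^ (q + 1)) *
            ∑ ι, (DhatSym d (x + axisVec ι 2) k + DhatSym d (x - axisVec ι 2) k) := by
      rw [Finset.mul_sum]
      refine Finset.sum_congr rfl fun ι _ => ?_
      ring
    rw [hsum]
    have hshift : ∑ ι, (DhatSym d (x + axisVec ι 2) k + DhatSym d (x - axisVec ι 2) k)
        = 2 * (d : ℝ) ^ 2 * (DhatSym d x k / d - 2 * Dsin d k * DhatSym d x k) := by
      have hd0 : (d : ℝ) ≠ 0 := by exact_mod_cast (show d ≠ 0 by omega)
      rw [hS]; field_simp; ring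
    rw [hshift]
    have hd0 : (d : ℝ) ≠ 0 := by exact_mod_cast (show d ≠ 0 by omega)
    field_simp
    ring
  -- integrate
  have hI1 : Integrable (fun k => a ^ q * f1 k - a ^ (q + 1) / d * f2 k) (P d) :=
    (hf1i.const_mul _).sub (hf2i.const_mul _)
  have hI2 : Integrable (fun k => a ^ (q + 1) / (2 * (d : ℝ) ^ 2) * ∑ ι, g ι k) (P d) :=
    (integrable_finsetSum _ fun ι _ => hgi ι).const_mul _
  have hint : ∫ k, (lapAtomsAt d cΦ αΦ cF αF RΦ RF k).Cstar ^ q * (lapAtomsAt d cΦ αΦ cF αF RΦ RF k).Mstar *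
        (Dhat d k ^ l * DhatSym d x k) ∂P d
      = a ^ q * (∫ k, f1 k ∂P d) - a ^ (q + 1) / d * (∫ k, f2 k ∂P d)
        + a ^ (q + 1) / (2 * (d : ℝ) ^ 2) * ∑ ι, ∫ k, g ι k ∂P d := by
    rw [integral_congr_ae (ae_of_all _ hpt), integral_add hI1 hI2,
      integral_sub (hf1i.const_mul _) (hf2i.const_mul _), integral_const_mul, integral_const_mul,
      integral_const_mul, integral_finsetSum _ fun ι _ => hgi ι]
  rw [hint]
  have hgint : ∀ ι, ∫ k, g ι k ∂P d
      = (srwIm d μ (q + 1) l (x + axisVec ι 2) + srwIm d μ (q + 1) l (x - axisVec ι 2)) * (2 * π) ^ d := by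
    intro ι
    rw [hg]
    simp only
    rw [integral_add (integrable_srwIm_integrand hμ0 hμ1 (q + 1) l _)
      (integrable_srwIm_integrand hμ0 hμ1 (q + 1) l _)]
    unfold srwIm
    field_simp
  simp_rw [hgint]
  unfold srwIm
  rw [← Finset.sum_mul]
  field_simp
  ring

/-- **(S1c) — the `m = −1` slot, print (3.63), upper side**: on the window (`c_F + α_F + R̂_F(0) < 1`), `α_F ≥ 1`, `d ≥ 5`:
`∫ Ĉ* M̂* D̂^l D̂^{(x)} dP/(2π)^d ≤ I_{1,l+1}(x)/α_F + Σ_ι (I_{2,l}(x+2e_ι) + I_{2,l}(x−2e_ι))/(2d² α_F²)`.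
[cite: FitznerVanDerHofstad2016NoBLE, §3.3.5 (3.63) p. 1076] -/
theorem integral_Cstar_Mstar_le (hd : 2 * 2 + 1 ≤ d) (hc0 : cF + αF + cosFT RF 0 < 1) (hα : 1 ≤ αF)
    (l : ℕ) (x : Fin d → ℤ) :
    (∫ k, (lapAtomsAt d cΦ αΦ cF αF RΦ RF k).Cstar * (lapAtomsAt d cΦ αΦ cF αF RΦ RF k).Mstar *
        (Dhat d k ^ l * DhatSym d x k) ∂P d) / (2 * π) ^ d
      ≤ srwI d 1 (l + 1) x / αF + srwIShift2 d 2 l x / (2 * (d : ℝ) ^ 2 * αF ^ 2) := by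
  have hα0 : 0 < αF := by linarith
  obtain ⟨ha, hμ0, hμ1⟩ := stepOne_params (d := d) (RF := RF) hc0 hα0.le
  have hexp := integral_Cstar_pow_Mstar_eq (d := d) (cΦ := cΦ) (αΦ := αΦ) (RΦ := RΦ) (by omega) hc0 hα0.le
    1 l x
  simp only [pow_one] at hexp
  rw [hexp]
  set a := stepOneA cF αF RF
  set μ := stepOneMu cF αF RF
  have hale : a ≤ 1 / αF := stepOneA_le_inv hc0.le hα0
  have hd0 : (0 : ℝ) < d := by exact_mod_cast (show 0 < d by omega)
  -- term 1
  have h1 : a * srwIm d μ 1 (l + 1) x ≤ srwI d 1 (l + 1) x / αF := by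
    have hI := srwIm_le_srwI (d := d) (n := 1) (by omega) hμ0 hμ1 (l + 1) x
    have hI0 := srwIm_nonneg (d := d) hμ0 hμ1 1 (l + 1) x
    calc a * srwIm d μ 1 (l + 1) x ≤ (1 / αF) * srwI d 1 (l + 1) x :=
          mul_le_mul hale hI hI0 (by positivity)
      _ = srwI d 1 (l + 1) x / αF := by ring
  -- term 2 ≤ 0
  have h2 : 0 ≤ a ^ (1 + 1) / d * srwIm d μ (1 + 1) l x :=
    mul_nonneg (by positivity) (srwIm_nonneg hμ0 hμ1 _ _ _)
  -- term 3
  have h3 : a ^ (1 + 1) / (2 * (d : ℝ) ^ 2) *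
        ∑ ι, (srwIm d μ (1 + 1) l (x + axisVec ι 2) + srwIm d μ (1 + 1) l (x - axisVec ι 2))
      ≤ srwIShift2 d 2 l x / (2 * (d : ℝ) ^ 2 * αF ^ 2) := by
    have hS : ∑ ι, (srwIm d μ (1 + 1) l (x + axisVec ι 2) + srwIm d μ (1 + 1) l (x - axisVec ι 2))
        ≤ srwIShift2 d 2 l x := by
      unfold srwIShift2
      exact Finset.sum_le_sum fun ι _ => add_le_add
        (srwIm_le_srwI (n := 2) hd hμ0 hμ1 l _) (srwIm_le_srwI (n := 2) hd hμ0 hμ1 l _)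
    have hS0 : 0 ≤ ∑ ι, (srwIm d μ (1 + 1) l (x + axisVec ι 2) + srwIm d μ (1 + 1) l (x - axisVec ι 2)) :=
      Finset.sum_nonneg fun ι _ => add_nonneg (srwIm_nonneg hμ0 hμ1 _ _ _) (srwIm_nonneg hμ0 hμ1 _ _ _)
    have ha2 : a ^ (1 + 1) ≤ (1 / αF) ^ 2 := by
      rw [show (1:ℕ) + 1 = 2 by norm_num]; exact pow_le_pow_left₀ ha.le hale 2
    calc a ^ (1 + 1) / (2 * (d : ℝ) ^ 2) * ∑ ι, (srwIm d μ (1 + 1) l (x + axisVec ι 2)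
              + srwIm d μ (1 + 1) l (x - axisVec ι 2))
        ≤ (1 / αF) ^ 2 / (2 * (d : ℝ) ^ 2) * srwIShift2 d 2 l x := by
          apply mul_le_mul _ hS hS0 (by positivity)
          exact div_le_div_of_nonneg_right ha2 (by positivity)
      _ = srwIShift2 d 2 l x / (2 * (d : ℝ) ^ 2 * αF ^ 2) := by
          field_simp
  linarith

/-- **(S1d) — the `m = −1` slot, lower side**: `−I_{2,l}(x)/(d α_F²) ≤ ∫ Ĉ* M̂* D̂^l D̂^{(x)} dP/(2π)^d`
(window, `α_F ≥ 1`, `d ≥ 5`). [cite: FitznerVanDerHofstad2016NoBLE, §3.3.5 (3.63) p. 1076] -/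
theorem neg_le_integral_Cstar_Mstar (hd : 2 * 2 + 1 ≤ d) (hc0 : cF + αF + cosFT RF 0 < 1) (hα : 1 ≤ αF)
    (l : ℕ) (x : Fin d → ℤ) :
    -(srwI d 2 l x / (d * αF ^ 2))
      ≤ (∫ k, (lapAtomsAt d cΦ αΦ cF αF RΦ RF k).Cstar * (lapAtomsAt d cΦ αΦ cF αF RΦ RF k).Mstar *
        (Dhat d k ^ l * DhatSym d x k) ∂P d) / (2 * π) ^ d := by
  have hα0 : 0 < αF := by linarith
  obtain ⟨ha, hμ0, hμ1⟩ := stepOne_params (d := d) (RF := RF) hc0 hα0.le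
  have hexp := integral_Cstar_pow_Mstar_eq (d := d) (cΦ := cΦ) (αΦ := αΦ) (RΦ := RΦ) (by omega) hc0 hα0.le
    1 l x
  simp only [pow_one] at hexp
  rw [hexp]
  set a := stepOneA cF αF RF
  set μ := stepOneMu cF αF RF
  have hale : a ≤ 1 / αF := stepOneA_le_inv hc0.le hα0
  have hd0 : (0 : ℝ) < d := by exact_mod_cast (show 0 < d by omega)
  have h1 : 0 ≤ a * srwIm d μ 1 (l + 1) x := mul_nonneg ha.le (srwIm_nonneg hμ0 hμ1 _ _ _)
  have h3 : 0 ≤ a ^ (1 + 1) / (2 * (d : ℝ) ^ 2) *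
      ∑ ι, (srwIm d μ (1 + 1) l (x + axisVec ι 2) + srwIm d μ (1 + 1) l (x - axisVec ι 2)) :=
    mul_nonneg (by positivity)
      (Finset.sum_nonneg fun ι _ => add_nonneg (srwIm_nonneg hμ0 hμ1 _ _ _) (srwIm_nonneg hμ0 hμ1 _ _ _))
  have h2 : a ^ (1 + 1) / d * srwIm d μ (1 + 1) l x ≤ srwI d 2 l x / (d * αF ^ 2) := by
    have hI := srwIm_le_srwI (d := d) (n := 2) hd hμ0 hμ1 l x
    have hI0 := srwIm_nonneg (d := d) hμ0 hμ1 2 l x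
    have ha2 : a ^ (1 + 1) ≤ (1 / αF) ^ 2 := by
      rw [show (1:ℕ) + 1 = 2 by norm_num]; exact pow_le_pow_left₀ ha.le hale 2
    calc a ^ (1 + 1) / d * srwIm d μ (1 + 1) l x ≤ (1 / αF) ^ 2 / d * srwI d 2 l x := by
          apply mul_le_mul _ hI hI0 (by positivity)
          exact div_le_div_of_nonneg_right ha2 hd0.le
      _ = srwI d 2 l x / (d * αF ^ 2) := by field_simp
  linarith

/-- Crude upper companion for the `m ≥ 0` slots (`q = m + 2`): dropping the non-positive middle term,
`∫ Ĉ*^q M̂* D̂^l D̂^{(x)} dP/(2π)^d ≤ I_{q,l+1}(x)/α_F^q + Σ_ι(I_{q+1,l}(x±2e_ι))/(2d² α_F^{q+1})` (`2(q+1)+1 ≤ d`).  The SHARP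
form with `𝓙_{q−2,l}` ((S1a)) needs the massive weighted line and is not in this module.
[cite: FitznerVanDerHofstad2016NoBLE, §3.3.5 (3.62) p. 1076] -/
theorem integral_Cstar_pow_Mstar_le_crude {q : ℕ} (hd : 2 * (q + 1) + 1 ≤ d)
    (hc0 : cF + αF + cosFT RF 0 < 1) (hα : 1 ≤ αF) (l : ℕ) (x : Fin d → ℤ) :
    (∫ k, (lapAtomsAt d cΦ αΦ cF αF RΦ RF k).Cstar ^ q * (lapAtomsAt d cΦ αΦ cF αF RΦ RF k).Mstar *
        (Dhat d k ^ l * DhatSym d x k) ∂P d) / (2 * π) ^ d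
      ≤ srwI d q (l + 1) x / αF ^ q + srwIShift2 d (q + 1) l x / (2 * (d : ℝ) ^ 2 * αF ^ (q + 1)) := by
  have hα0 : 0 < αF := by linarith
  obtain ⟨ha, hμ0, hμ1⟩ := stepOne_params (d := d) (RF := RF) hc0 hα0.le
  rw [integral_Cstar_pow_Mstar_eq (d := d) (cΦ := cΦ) (αΦ := αΦ) (RΦ := RΦ) (by omega) hc0 hα0.le q l x]
  set a := stepOneA cF αF RF
  set μ := stepOneMu cF αF RF
  have hale : a ≤ 1 / αF := stepOneA_le_inv hc0.le hα0
  have hd0 : (0 : ℝ) < d := by exact_mod_cast (show 0 < d by omega)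
  have haq : ∀ n : ℕ, a ^ n ≤ (1 / αF) ^ n := fun n => pow_le_pow_left₀ ha.le hale n
  have h1 : a ^ q * srwIm d μ q (l + 1) x ≤ srwI d q (l + 1) x / αF ^ q := by
    have hI := srwIm_le_srwI (d := d) (n := q) (by omega) hμ0 hμ1 (l + 1) x
    have hI0 := srwIm_nonneg (d := d) hμ0 hμ1 q (l + 1) x
    calc a ^ q * srwIm d μ q (l + 1) x ≤ (1 / αF) ^ q * srwI d q (l + 1) x :=
          mul_le_mul (haq q) hI hI0 (by positivity)
      _ = srwI d q (l + 1) x / αF ^ q := by rw [one_div, inv_pow]; ring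
  have h2 : 0 ≤ a ^ (q + 1) / d * srwIm d μ (q + 1) l x :=
    mul_nonneg (by positivity) (srwIm_nonneg hμ0 hμ1 _ _ _)
  have h3 : a ^ (q + 1) / (2 * (d : ℝ) ^ 2) *
        ∑ ι, (srwIm d μ (q + 1) l (x + axisVec ι 2) + srwIm d μ (q + 1) l (x - axisVec ι 2))
      ≤ srwIShift2 d (q + 1) l x / (2 * (d : ℝ) ^ 2 * αF ^ (q + 1)) := by
    have hS : ∑ ι, (srwIm d μ (q + 1) l (x + axisVec ι 2) + srwIm d μ (q + 1) l (x - axisVec ι 2))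
        ≤ srwIShift2 d (q + 1) l x := by
      unfold srwIShift2
      exact Finset.sum_le_sum fun ι _ => add_le_add
        (srwIm_le_srwI (n := q + 1) hd hμ0 hμ1 l _) (srwIm_le_srwI (n := q + 1) hd hμ0 hμ1 l _)
    have hS0 : 0 ≤ ∑ ι, (srwIm d μ (q + 1) l (x + axisVec ι 2) + srwIm d μ (q + 1) l (x - axisVec ι 2)) :=
      Finset.sum_nonneg fun ι _ => add_nonneg (srwIm_nonneg hμ0 hμ1 _ _ _) (srwIm_nonneg hμ0 hμ1 _ _ _)
    calc a ^ (q + 1) / (2 * (d : ℝ) ^ 2) * ∑ ι, (srwIm d μ (q + 1) l (x + axisVec ι 2)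
              + srwIm d μ (q + 1) l (x - axisVec ι 2))
        ≤ (1 / αF) ^ (q + 1) / (2 * (d : ℝ) ^ 2) * srwIShift2 d (q + 1) l x := by
          apply mul_le_mul _ hS hS0 (by positivity)
          exact div_le_div_of_nonneg_right (haq (q + 1)) (by positivity)
      _ = srwIShift2 d (q + 1) l x / (2 * (d : ℝ) ^ 2 * αF ^ (q + 1)) := by
          rw [one_div, inv_pow]; field_simp
  linarith

/-- Crude lower companion for the `m ≥ 0` slots: `−I_{q+1,l}(x)/(d α_F^{q+1}) ≤ ∫ Ĉ*^q M̂* D̂^l D̂^{(x)} dP/(2π)^d`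
(`2(q+1)+1 ≤ d`). The form `−(α_F−1)S/(2d²α_F^{q+1})` ((S1b)) needs the massive weighted line (positivity of the
`W`-part) and is not in this module. [cite: FitznerVanDerHofstad2016NoBLE, §3.3.5 (3.62) p. 1076] -/
theorem neg_le_integral_Cstar_pow_Mstar_crude {q : ℕ} (hd : 2 * (q + 1) + 1 ≤ d)
    (hc0 : cF + αF + cosFT RF 0 < 1) (hα : 1 ≤ αF) (l : ℕ) (x : Fin d → ℤ) :
    -(srwI d (q + 1) l x / (d * αF ^ (q + 1)))
      ≤ (∫ k, (lapAtomsAt d cΦ αΦ cF αF RΦ RF k).Cstar ^ q * (lapAtomsAt d cΦ αΦ cF αF RΦ RF k).Mstar *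
        (Dhat d k ^ l * DhatSym d x k) ∂P d) / (2 * π) ^ d := by
  have hα0 : 0 < αF := by linarith
  obtain ⟨ha, hμ0, hμ1⟩ := stepOne_params (d := d) (RF := RF) hc0 hα0.le
  rw [integral_Cstar_pow_Mstar_eq (d := d) (cΦ := cΦ) (αΦ := αΦ) (RΦ := RΦ) (by omega) hc0 hα0.le q l x]
  set a := stepOneA cF αF RF
  set μ := stepOneMu cF αF RF
  have hale : a ≤ 1 / αF := stepOneA_le_inv hc0.le hα0
  have hd0 : (0 : ℝ) < d := by exact_mod_cast (show 0 < d by omega)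
  have haq : ∀ n : ℕ, a ^ n ≤ (1 / αF) ^ n := fun n => pow_le_pow_left₀ ha.le hale n
  have h1 : 0 ≤ a ^ q * srwIm d μ q (l + 1) x := mul_nonneg (pow_nonneg ha.le q) (srwIm_nonneg hμ0 hμ1 _ _ _)
  have h3 : 0 ≤ a ^ (q + 1) / (2 * (d : ℝ) ^ 2) *
      ∑ ι, (srwIm d μ (q + 1) l (x + axisVec ι 2) + srwIm d μ (q + 1) l (x - axisVec ι 2)) :=
    mul_nonneg (by positivity)
      (Finset.sum_nonneg fun ι _ => add_nonneg (srwIm_nonneg hμ0 hμ1 _ _ _) (srwIm_nonneg hμ0 hμ1 _ _ _))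
  have h2 : a ^ (q + 1) / d * srwIm d μ (q + 1) l x ≤ srwI d (q + 1) l x / (d * αF ^ (q + 1)) := by
    have hI := srwIm_le_srwI (d := d) (n := q + 1) hd hμ0 hμ1 l x
    have hI0 := srwIm_nonneg (d := d) hμ0 hμ1 (q + 1) l x
    calc a ^ (q + 1) / d * srwIm d μ (q + 1) l x ≤ (1 / αF) ^ (q + 1) / d * srwI d (q + 1) l x := by
          apply mul_le_mul _ hI hI0 (by positivity)
          exact div_le_div_of_nonneg_right (haq (q + 1)) hd0.le
      _ = srwI d (q + 1) l x / (d * αF ^ (q + 1)) := by rw [one_div, inv_pow]; field_simp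
  linarith

end StepOne

end Literature.Probability.FitznerVanDerHofstad2017
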